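import Summits.BirchSwinnertonDyer.BirchSwinnertonDyer.Theses.RamifiedHeegnerPair
import Literature.NumberTheory.EllipticCurves.RankLeOneOfLocalComponentsProofs
import Literature.NumberTheory.EllipticCurves.GrossZagierRationalPointFHProofs
import Literature.NumberTheory.EllipticCurves.AnalyticRankModularityProofs
import Literature.NumberTheory.Automorphic.ShimuraCurveRibetTakahashiOptimalProofs
import HarnessLib

set_option autoImplicit false
-- the sub-problem namespace `Summit.BirchSwinnertonDyer.BirchSwinnertonDyer` duplicates a component by design (D-0017)
set_option linter.dupNamespace false

/-!
# Route `RamifiedHeegnerPair`: the print item PUB⁺ `LeafRankOnePrintedInputsAtThree` (stmt-BirchSwinnertonDyer-27491)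
# follows from NINE of its thirteen conjuncts and Friedberg–Hoffstein's class statement

HONEST FRAMING. Theorems only; a helper file (`--supports`), nothing is booked, no item is closed, BSD is proved for no
curve. Lead prover bsd-line-rhp-p2 g77, 2026-08-31 (cruxes U₁ 26022 / U₀ 26024, lines `partnerdescent` v18 /
`splitkolyvagin0` v31).

The route's support item 27491 `LeafRankOnePrintedInputsAtThree` (PUB⁺, "permanently open print") is the 13-fold
conjunction GZ ∀ · Kolyvagin ∀ · bsd.S17 (`rank_eq_analyticRank_of_analyticRank_le_one`) · `hasEntireLFunction_rat` ·
GZ I.(7.3) · Matar–Nekovář 0.7 · `exists_isNewformOf` · `friedbergHoffstein_exists_heegnerField_splitDivisors_twist_ne_zero` ·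
`nonempty_modularParametrizationData` · Cassels · Mazur · Abbes–Ullmo · Česnavičius. FOUR of these are THEOREMS of the tree
over the other nine and Friedberg–Hoffstein 1995 Thm. B on a class with prescribed local components
(`friedbergHoffstein_exists_twist_prescribedLocalComponents`, a cite-only name both lines already hold in PRINT-ALL):

* conjunct 3, bsd.S17 ⟸ GZ ∀ ∧ Kolyvagin ∀ ∧ `exists_isNewformOf` ∧ FH-CLASS —
  `rank_eq_analyticRank_of_analyticRank_le_one_of_prescribedLocalComponents` (‹Literature/NumberTheory/EllipticCurves/RankLeOneOfLocalComponentsProofs›,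
  p827845: Darmon 2004 §3.9 as assembled in `HeegnerPointsModularityProofs`, the rational Manin constant
  `IsNewformOf.exists_maninConstant_ne_zero_holds`, Waldspurger's and Murty–Murty's non-vanishing theorems from FH Thm. B);
* conjunct 4, `L(E, s)` entire ⟸ `exists_isNewformOf` — `WeierstrassCurve.hasEntireLFunction_rat_of_exists_isNewformOf`;
* conjunct 8, the Heegner field with prescribed split divisors and `L(W^{(d_K)}, 1) ≠ 0` ⟸ FH-CLASS ∧ `exists_isNewformOf` —
  `friedbergHoffstein_exists_heegnerField_splitDivisors_twist_ne_zero_of_prescribedLocalComponents` (p827265);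
* conjunct 9, BCDT's form (6) ⟺ `exists_isNewformOf` — `nonempty_modularParametrizationData_iff_exists_isNewformOf_unconditional`.

`leafRankOnePrintedInputsAtThree_of_core` is the by-name certificate «27491 ⟸ core₉ ∧ FH-CLASS» for the planner (the item's
text is the planner's; skeleton `partnerdescent` v18 reads PUB⁺ through `stub_publishedInputsU1Core` = core₉ and derives the item by
name with the same term). `core_of_leafRankOnePrintedInputsAtThree` is the trivial converse (projections), so that over FH-CLASS
the item and its core are EQUIVALENT (`leafRankOnePrintedInputsAtThree_iff_core`). No definition is introduced (the core is spelled out). [cite: Darmon2004, Thm. 3.22 and §3.9]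
[cite: FriedbergHoffstein1995, Thm. B] [cite: BCDTJAMS2001, Thm. A and p. 845, (2) ⇔ (6)] [cite: DiamondShurman2005, Thm. 5.10.2]
-/

namespace Summit.BirchSwinnertonDyer.BirchSwinnertonDyer.Theorems.RamifiedHeegnerPairPrintedInputs

open Summit.BirchSwinnertonDyer.BirchSwinnertonDyer.Theses.RamifiedHeegnerPair
open Literature.NumberTheory.EllipticCurves Literature.NumberTheory.EllipticCurves.ModularForms

/-- **PUB⁺ (item 27491) from its nine-name core and Friedberg–Hoffstein's class statement.** The core `hcore` is item
27491's conjuncts 1, 2, 5, 6, 7, 10, 11, 12, 13 verbatim (Gross–Zagier ∀ · Kolyvagin ∀ · GZ I.(7.3) · Matar–Nekovář 2019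
Thm. 0.7 · `exists_isNewformOf` · Cassels' isogeny invariance · Mazur 1978 Cor. 4.1 · Abbes–Ullmo 1996 Thm. A · Česnavičius
2018 Thm. 1.2); conjuncts 3 (bsd.S17), 4 (`L` entire), 8 (Heegner-field non-vanishing supply) and 9 (form (6)) are supplied by
the tree theorems named in the module docstring. CONDITIONAL (every input a named fact); closes nothing.
[cite: GrossZagier1986, Thm. I.(6.3) and (7.3)] [cite: MatarNekovar2019, Thm. 0.7 (p. 456)] [cite: Mazur1978, Cor. 4.1] [cite: Darmon2004, Thm. 3.22 and §3.9]
[cite: FriedbergHoffstein1995, Thm. B] [cite: BCDTJAMS2001, Thm. A and p. 845, (2) ⇔ (6)] -/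
theorem leafRankOnePrintedInputsAtThree_of_core
    (hcore : ((∀ (N : ℕ) [NeZero N] (W : WeierstrassCurve ℚ) (K : Type) [Field K] [NumberField K], gross_zagier N W K) ∧
      (∀ (N : ℕ) [NeZero N] (W : WeierstrassCurve ℚ) (K : Type) [Field K] [NumberField K], kolyvagin N W K) ∧
      GrossZagier1986_thm_I_7_3 ∧
      MatarNekovar2019.thm07_padicValNat_card_sha_primary_add_le_of_globalDivisibility_of_irreducible ∧
      exists_isNewformOf ∧
      WeierstrassCurve.bsdRHS_eq_of_isIsogenous ∧
      mazur_not_dvd_maninConstant_of_odd ∧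
      abbesUllmo_not_dvd_maninConstant_of_not_dvd_level ∧
      cesnavicius_not_two_dvd_maninConstant_of_two_dvd_level))
    (hFH : friedbergHoffstein_exists_twist_prescribedLocalComponents) : LeafRankOnePrintedInputsAtThree := by
  obtain ⟨hGZ, hKo, h73, hMN, hmod, hrest⟩ := hcore
  unfold LeafRankOnePrintedInputsAtThree
  exact ⟨hGZ, hKo, rank_eq_analyticRank_of_analyticRank_le_one_of_prescribedLocalComponents hGZ hKo hmod hFH,
    WeierstrassCurve.hasEntireLFunction_rat_of_exists_isNewformOf hmod, h73, hMN, hmod,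
    friedbergHoffstein_exists_heegnerField_splitDivisors_twist_ne_zero_of_prescribedLocalComponents hFH hmod,
    nonempty_modularParametrizationData_iff_exists_isNewformOf_unconditional.mpr hmod, hrest⟩

/-- **The trivial converse**: PUB⁺ implies its core (projections). [folklore] -/
theorem core_of_leafRankOnePrintedInputsAtThree (h : LeafRankOnePrintedInputsAtThree) :
    ((∀ (N : ℕ) [NeZero N] (W : WeierstrassCurve ℚ) (K : Type) [Field K] [NumberField K], gross_zagier N W K) ∧
      (∀ (N : ℕ) [NeZero N] (W : WeierstrassCurve ℚ) (K : Type) [Field K] [NumberField K], kolyvagin N W K) ∧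
      GrossZagier1986_thm_I_7_3 ∧
      MatarNekovar2019.thm07_padicValNat_card_sha_primary_add_le_of_globalDivisibility_of_irreducible ∧
      exists_isNewformOf ∧
      WeierstrassCurve.bsdRHS_eq_of_isIsogenous ∧
      mazur_not_dvd_maninConstant_of_odd ∧
      abbesUllmo_not_dvd_maninConstant_of_not_dvd_level ∧
      cesnavicius_not_two_dvd_maninConstant_of_two_dvd_level) := by
  unfold LeafRankOnePrintedInputsAtThree at h
  obtain ⟨hGZ, hKo, -, -, h73, hMN, hmod, -, -, hrest⟩ := h
  exact ⟨hGZ, hKo, h73, hMN, hmod, hrest⟩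

/-- **Over Friedberg–Hoffstein's class statement, PUB⁺ (item 27491) is EQUIVALENT to its nine-name core.**
[cite: FriedbergHoffstein1995, Thm. B] [cite: Darmon2004, Thm. 3.22 and §3.9] -/
theorem leafRankOnePrintedInputsAtThree_iff_core (hFH : friedbergHoffstein_exists_twist_prescribedLocalComponents) :
    LeafRankOnePrintedInputsAtThree ↔
      ((∀ (N : ℕ) [NeZero N] (W : WeierstrassCurve ℚ) (K : Type) [Field K] [NumberField K], gross_zagier N W K) ∧
      (∀ (N : ℕ) [NeZero N] (W : WeierstrassCurve ℚ) (K : Type) [Field K] [NumberField K], kolyvagin N W K) ∧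
      GrossZagier1986_thm_I_7_3 ∧
      MatarNekovar2019.thm07_padicValNat_card_sha_primary_add_le_of_globalDivisibility_of_irreducible ∧
      exists_isNewformOf ∧
      WeierstrassCurve.bsdRHS_eq_of_isIsogenous ∧
      mazur_not_dvd_maninConstant_of_odd ∧
      abbesUllmo_not_dvd_maninConstant_of_not_dvd_level ∧
      cesnavicius_not_two_dvd_maninConstant_of_two_dvd_level) :=
  ⟨core_of_leafRankOnePrintedInputsAtThree, fun h ↦ leafRankOnePrintedInputsAtThree_of_core h hFH⟩

/-! ## §2 The EIGHT-name core (line `partnerdescent` v19): Gross–Zagier I.(7.3) is derived too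

Item 27491's conjunct 5 `GrossZagier1986_thm_I_7_3` (GZ86 V.§2: `L(E,1) = 0 ⇒ L'(E,1) = α·Ω·ĥ(P)`, and (7.2) up to `ℚ^×`
in rank one) is a theorem of the tree over BCDT form (6), the split-form Friedberg–Hoffstein supply and the Gross–Zagier
formula — `GrossZagier1986_thm_I_7_3_of_friedbergHoffstein` (‹Literature/NumberTheory/EllipticCurves/GrossZagierRationalPointFHProofs›,
cell bsd-print-cf2) — and those three follow from the core and FH-CLASS as in §1. So PUB⁺ ⟺ its EIGHT-name core
(conjuncts 1, 2, 6, 7, 10, 11, 12, 13) over FH-CLASS. -/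

/-- **PUB⁺ (item 27491) from its EIGHT-name core and Friedberg–Hoffstein's class statement.** The core is item 27491's
conjuncts 1, 2, 6, 7, 10, 11, 12, 13 verbatim (Gross–Zagier ∀ · Kolyvagin ∀ · Matar–Nekovář 2019 Thm. 0.7 · `exists_isNewformOf` ·
Cassels · Mazur · Abbes–Ullmo · Česnavičius); GZ I.(7.3) is supplied by `GrossZagier1986_thm_I_7_3_of_friedbergHoffstein` over form (6)
(`nonempty_modularParametrizationData_iff_exists_isNewformOf_unconditional`), the split-form FH supply
(`friedbergHoffstein_exists_heegnerField_split_twist_ne_zero_of_splitDivisors` ∘ `…splitDivisors…_of_prescribedLocalComponents`) and GZ ∀,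
then §1 concludes. CONDITIONAL; closes nothing. [cite: GrossZagier1986, Thm. I.(7.3) (p. 231); V.§2] [cite: FriedbergHoffstein1995, Thm. B]
[cite: Darmon2004, Thm. 3.22 and §3.9] -/
theorem leafRankOnePrintedInputsAtThree_of_core8
    (hcore : ((∀ (N : ℕ) [NeZero N] (W : WeierstrassCurve ℚ) (K : Type) [Field K] [NumberField K], gross_zagier N W K) ∧
      (∀ (N : ℕ) [NeZero N] (W : WeierstrassCurve ℚ) (K : Type) [Field K] [NumberField K], kolyvagin N W K) ∧
      MatarNekovar2019.thm07_padicValNat_card_sha_primary_add_le_of_globalDivisibility_of_irreducible ∧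
      exists_isNewformOf ∧
      WeierstrassCurve.bsdRHS_eq_of_isIsogenous ∧
      mazur_not_dvd_maninConstant_of_odd ∧
      abbesUllmo_not_dvd_maninConstant_of_not_dvd_level ∧
      cesnavicius_not_two_dvd_maninConstant_of_two_dvd_level))
    (hFH : friedbergHoffstein_exists_twist_prescribedLocalComponents) : LeafRankOnePrintedInputsAtThree := by
  obtain ⟨hGZ, hKo, hMN, hmod, hrest⟩ := hcore
  have hmodP : nonempty_modularParametrizationData :=
    nonempty_modularParametrizationData_iff_exists_isNewformOf_unconditional.mpr hmod
  have hFHs : friedbergHoffstein_exists_heegnerField_splitDivisors_twist_ne_zero :=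
    friedbergHoffstein_exists_heegnerField_splitDivisors_twist_ne_zero_of_prescribedLocalComponents hFH hmod
  exact leafRankOnePrintedInputsAtThree_of_core
    ⟨hGZ, hKo, GrossZagier1986_thm_I_7_3_of_friedbergHoffstein hmodP
      (friedbergHoffstein_exists_heegnerField_split_twist_ne_zero_of_splitDivisors hFHs) hGZ, hMN, hmod, hrest⟩ hFH

/-- **The trivial converse for the eight-name core** (projections). [folklore] -/
theorem core8_of_leafRankOnePrintedInputsAtThree (h : LeafRankOnePrintedInputsAtThree) :
    ((∀ (N : ℕ) [NeZero N] (W : WeierstrassCurve ℚ) (K : Type) [Field K] [NumberField K], gross_zagier N W K) ∧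
      (∀ (N : ℕ) [NeZero N] (W : WeierstrassCurve ℚ) (K : Type) [Field K] [NumberField K], kolyvagin N W K) ∧
      MatarNekovar2019.thm07_padicValNat_card_sha_primary_add_le_of_globalDivisibility_of_irreducible ∧
      exists_isNewformOf ∧
      WeierstrassCurve.bsdRHS_eq_of_isIsogenous ∧
      mazur_not_dvd_maninConstant_of_odd ∧
      abbesUllmo_not_dvd_maninConstant_of_not_dvd_level ∧
      cesnavicius_not_two_dvd_maninConstant_of_two_dvd_level) := by
  unfold LeafRankOnePrintedInputsAtThree at h
  obtain ⟨hGZ, hKo, -, -, -, hMN, hmod, -, -, hrest⟩ := h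
  exact ⟨hGZ, hKo, hMN, hmod, hrest⟩

/-- **Over Friedberg–Hoffstein's class statement, PUB⁺ (item 27491) is EQUIVALENT to its EIGHT-name core.**
[cite: FriedbergHoffstein1995, Thm. B] [cite: GrossZagier1986, Thm. I.(7.3)] [cite: Darmon2004, Thm. 3.22 and §3.9] -/
theorem leafRankOnePrintedInputsAtThree_iff_core8 (hFH : friedbergHoffstein_exists_twist_prescribedLocalComponents) :
    LeafRankOnePrintedInputsAtThree ↔
      ((∀ (N : ℕ) [NeZero N] (W : WeierstrassCurve ℚ) (K : Type) [Field K] [NumberField K], gross_zagier N W K) ∧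
      (∀ (N : ℕ) [NeZero N] (W : WeierstrassCurve ℚ) (K : Type) [Field K] [NumberField K], kolyvagin N W K) ∧
      MatarNekovar2019.thm07_padicValNat_card_sha_primary_add_le_of_globalDivisibility_of_irreducible ∧
      exists_isNewformOf ∧
      WeierstrassCurve.bsdRHS_eq_of_isIsogenous ∧
      mazur_not_dvd_maninConstant_of_odd ∧
      abbesUllmo_not_dvd_maninConstant_of_not_dvd_level ∧
      cesnavicius_not_two_dvd_maninConstant_of_two_dvd_level) :=
  ⟨core8_of_leafRankOnePrintedInputsAtThree, fun h ↦ leafRankOnePrintedInputsAtThree_of_core8 h hFH⟩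

end Summit.BirchSwinnertonDyer.BirchSwinnertonDyer.Theorems.RamifiedHeegnerPairPrintedInputs
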